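import Summits.QuantumFields.BalabanUV.T4Continuum.Support.NE7K1LinTorusFluctDecay

/-!
# NE7K1LinTorusKernelDecay — row NE7 (node U5), candidate route HOM, path H1L, cell K1-lin(s): I3 ON THE TORUS — the doubled-torus
# two-cutoff line `T^𝕋(s)` is EXPONENTIALLY LOCALISED IN THE TORUS DISTANCE, uniformly in `s ∈ [0,1]`, in the mesh `n` and in the
# torus size (NEEDS-ESTIMATE #E1, the input of B-E1's strip clauses (b′)(e′))

Lineage `b2b-balaban-t4-ne7-p2` (CRUX PROVER NE7 #2), generation 73; file 44 — the torus twin of file 28 §2 (`NE7K1LinSchurKernelDecay`).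
File 42 supplied the entries of `H_B^𝕋` and the geometry (with the CENTRE `c₀ = (K_μ)` of the representatives `boxDom (dbl K)` as base
point the plain sup-norm `ρ(x) = |x − c₀|_∞` is the torus distance to `c₀`, 1-Lipschitz along torus bonds), file 43 the Combes–Thomas
bound `|D⁻¹(p,q)| ≤ (L^{d+1}∕n²)·e^{−θ(ρ(site p) − ρ(site q))}` for the fluctuation block; translation invariance of the line (file 36)
moves the base point anywhere.

* §1 **`torSchur_correction_entry_decay`**: `|((H_B^𝕋)₁₂D⁻¹(H_B^𝕋)₂₁)(x,y)| ≤ n²·C_𝕋(d,L)·e^{−θ(ρ(x) − ρ(y) − 2)}`,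
  `C_𝕋 = 64(d+1)²(2d+3)²L^{d+5}` (at most `(2d+3)L^{d+1}` fluctuation labels sit over sites equal or torus-adjacent to a given one);
  the local parts `(H_B^𝕋)₁₁`, `n²(−Δ^𝕋_c)` have torus range one; hence **`torLine_entry_decay_ctr`**:
  `|T^𝕋(s)(x, c₀)| ≤ 2n²·C_𝕋·e^{−θ(ρ(x) − 2)}` for EVERY `x` and every `s ∈ [0,1]` (`a = 0`; `θ ≥ 0` with file 28's mesh-free
  condition `16(d+1)²L^{d+3}(e^θ − 1) ≤ 1`).
* §2 by translation invariance **`torLine_entry_decay`**: `|T^𝕋(s)(x, y)| ≤ 2n²·C_𝕋·e^{−θ(|(x + (c₀ − y)) mod 2nM − c₀|_∞ − 2)}` for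
  ALL labels `x, y` — the argument of the exponential is the TORUS sup-distance of `x` and `y`: I3 on the doubled torus of every size,
  mesh- and `s`-uniformly (rate and prefactor∕n² free of `n` and `M`).

HONEST FRAMING: [folklore]; ONE scale, `a = 0`, U = 1, crude explicit constants; the INPUT of B-E1's strip clauses, NOT the clauses
(Paley–Wiener on the torus symbol is the next file); nothing of Bałaban's asserted; no `sorry`.  Census only; NE7 NOT PRINTED ∕ NOT
PROVED; spine 0∕9; FIXED FINITE T⁴, rung (B)+1; NOT infinite volume, NOT mass gap, NOT Clay.  HONEST DEPENDENCY: continuum YM on T⁴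
⇐ BetaPertH ∧ nine spine estimates (0/9 proved); BetaPertH ⇐ (D1) ∧ (D4) ∧ CAP+tail; G-an2-4 gates asym, D1 and NE2/3/4.
-/

noncomputable section

open Finset Matrix

namespace Summit.QuantumFields.BalabanUV.T4Continuum.NE7K1LinTorusKernelDecay

open Literature.MathematicalPhysics.QuantumFieldTheory.Balaban1983to89
open Literature.MathematicalPhysics.QuantumFieldTheory.Balaban1983to89.B4ContourShift (supNorm supNorm_nonneg abs_le_supNorm
  exists_supNorm_eq)
open Literature.MathematicalPhysics.QuantumFieldTheory.Balaban1983to89.B4Reflection242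
open Literature.MathematicalPhysics.QuantumFieldTheory.Balaban1983to89.B4Lower18
open Literature.MathematicalPhysics.QuantumFieldTheory.Balaban1983to89.B4TorusPositivity (wrap wrap_wrap_add)
open Literature.MathematicalPhysics.QuantumFieldTheory.Balaban1983to89.Beta.CombesThomasForm (combesThomas_form abs_exp_sub_one_le)
open NE7K1LinFoldKernels NE7K1LinFoldMatrices NE7K1LinSchurFold NE7K1LinTorusChart NE7K1LinSchurFoldBox
  NE7K1LinTorusLineInvariant NE7K1LinTorusLineSymbol NE7K1LinTorusSymbolReal NE7K1LinTorusJensen NE7K1LinTorusFloor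
  NE7K1LinTorusEntries NE7K1LinTorusFluctDecay NE7K1LinBlockCoords NE7K1LinSchurLineU1 NE7K1LinSchurLineForm NE7K1LinTwoRunKit
  NE7K1LinWalkLine NE7K1LinWalkLineEntries NE7K1LinWalkLineBlocks NE7K1LinSchurBilinError NE7K1LinSchurKernelDecay

variable {d : ℕ} {n L : ℕ} [NeZero L] {K Nf : Fin (d + 1) → ℕ} {T : Finset (Fin (d + 1) → ℤ)}

/-! ### §1 The Schur correction decays; the local parts have torus range one; the line -/

section Line

/-- at most `2d+3` labels are equal or torus-adjacent to a given one; lifted to the fluctuation labels: `≤ (2d+3)·L^{d+1}`. [folklore] -/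
theorem card_filter_near_le (hK : ∀ i, 1 ≤ K i) (hNf : Nf = fun i => L * K i) (hT : T = boxDom (dbl Nf))
    (x : ↥(T.image (blk L))) :
    ((univ.filter fun p : ↥(T.image (blk L)) × NZ d L => x = p.1 ∨ tadj K x.1 p.1.1 ≠ 0).card : ℝ) ≤
      (2 * (d : ℝ) + 3) * (L : ℝ) ^ (d + 1) := by
  classical
  have hTc := labels_eq hNf hT
  refine card_filter_fst_le' (fun b : ↥(T.image (blk L)) => x = b ∨ tadj K x.1 b.1 ≠ 0) ?_
  have hsub : (univ.filter fun b : ↥(T.image (blk L)) => x = b ∨ tadj K x.1 b.1 ≠ 0) ⊆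
      {x} ∪ (univ.filter fun b : ↥(T.image (blk L)) => tadj K x.1 b.1 ≠ 0) := by
    intro b hb
    simp only [Finset.mem_filter, Finset.mem_univ, true_and] at hb
    simp only [Finset.mem_union, Finset.mem_singleton, Finset.mem_filter, Finset.mem_univ, true_and]
    rcases hb with h | h
    · exact Or.inl h.symm
    · exact Or.inr h
  have hcard := (Finset.card_le_card hsub).trans (Finset.card_union_le _ _)
  rw [Finset.card_singleton] at hcard
  have h2 := (card_filter_tadj_le hK hTc x).1
  have h3 : ((univ.filter fun b : ↥(T.image (blk L)) => x = b ∨ tadj K x.1 b.1 ≠ 0).card : ℝ) ≤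
      1 + ((univ.filter fun b : ↥(T.image (blk L)) => tadj K x.1 b.1 ≠ 0).card : ℝ) := by exact_mod_cast hcard
  linarith

/-- labels within torus distance one of `x` are at most one step farther ∕ closer to the centre. [folklore] -/
theorem supNorm_near (hK : ∀ i, 1 ≤ K i) (hNf : Nf = fun i => L * K i) (hT : T = boxDom (dbl Nf))
    {x b : ↥(T.image (blk L))} (h : x = b ∨ tadj K x.1 b.1 ≠ 0) :
    |supNorm (x.1 - fun i => (K i : ℤ)) - supNorm (b.1 - fun i => (K i : ℤ))| ≤ 1 := by
  rcases h with rfl | h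
  · simp
  · exact abs_supNorm_sub_ctr_sub_le hK (label_mem hNf hT x) (label_mem hNf hT b) h

/-- **THE NON-LOCAL PART OF THE TORUS SCHUR COMPLEMENT DECAYS**: for `θ ≥ 0` with `16(d+1)²L^{d+3}(e^θ − 1) ≤ 1` and all labels
`x, y`: `|((H_B^𝕋)₁₂·D⁻¹·(H_B^𝕋)₂₁)(x,y)| ≤ n²·64(d+1)²(2d+3)²L^{d+5}·e^{−θ(|x − c₀|_∞ − |y − c₀|_∞ − 2)}`. [folklore] -/
theorem torSchur_correction_entry_decay (hn : 1 ≤ n) (hK : ∀ i, 1 ≤ K i) (hNf : Nf = fun i => L * K i)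
    (hT : T = boxDom (dbl Nf)) (hT' : IsBlockUnion (n * L) T) {θ : ℝ} (hθ : 0 ≤ θ)
    (hθs : 16 * ((d : ℝ) + 1) ^ 2 * (L : ℝ) ^ (d + 3) * (Real.exp θ - 1) ≤ 1) (x y : ↥(T.image (blk L))) :
    |((torB (isBlockUnion_fine hT') n 0 Nf).toBlocks₁₂ * ((torB (isBlockUnion_fine hT') n 0 Nf).toBlocks₂₂)⁻¹ *
        (torB (isBlockUnion_fine hT') n 0 Nf).toBlocks₂₁) x y| ≤
      (n : ℝ) ^ 2 * (64 * ((d : ℝ) + 1) ^ 2 * (2 * (d : ℝ) + 3) ^ 2 * (L : ℝ) ^ (d + 5)) *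
        Real.exp (-(θ * (supNorm (x.1 - fun i => (K i : ℤ)) - supNorm (y.1 - fun i => (K i : ℤ)) - 2))) := by
  classical
  have hNf' : ∀ i, 1 ≤ Nf i := by subst hNf; exact mul_pos_side (NeZero.one_le : 1 ≤ L) hK
  set H := torB (isBlockUnion_fine hT') n 0 Nf with hH
  have hL0 : (0 : ℝ) < L := by exact_mod_cast (NeZero.one_le : 1 ≤ L)
  have hn0 : (0 : ℝ) < n := by exact_mod_cast hn
  set θD : ℝ := 8 * ((d : ℝ) + 1) * ((n : ℝ) * L) ^ 2 / (L : ℝ) ^ (d + 1) with hθD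
  have hθD0 : 0 ≤ θD := by rw [hθD]; positivity
  set ρx := supNorm (x.1 - fun i => (K i : ℤ)) with hρx
  set ρy := supNorm (y.1 - fun i => (K i : ℤ)) with hρy
  set Kq : ℝ := (L : ℝ) ^ (d + 1) / (n : ℝ) ^ 2 * Real.exp (-(θ * (ρx - ρy - 2))) with hKq
  have hKq0 : 0 ≤ Kq := by rw [hKq]; positivity
  rw [Matrix.mul_apply]
  simp_rw [Matrix.mul_apply, Finset.sum_mul]
  have hterm : ∀ q p, |H.toBlocks₁₂ x p * (H.toBlocks₂₂)⁻¹ p q * H.toBlocks₂₁ q y| ≤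
      (if (x = p.1 ∨ tadj K x.1 p.1.1 ≠ 0) then (1 : ℝ) else 0) * (if (y = q.1 ∨ tadj K y.1 q.1.1 ≠ 0) then (1 : ℝ) else 0) *
        (θD * Kq * θD) := by
    intro q p
    by_cases h12 : H.toBlocks₁₂ x p = 0
    · rw [h12, zero_mul, zero_mul, abs_zero]; positivity
    by_cases h21 : H.toBlocks₂₁ q y = 0
    · rw [h21, mul_zero, abs_zero]; positivity
    have hxp : x = p.1 ∨ tadj K x.1 p.1.1 ≠ 0 :=
      torB_zero_ne_zero_adj hK hNf hT (isBlockUnion_fine hT') (c := Sum.inl x) (c' := Sum.inr p) h12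
    have hyq : y = q.1 ∨ tadj K y.1 q.1.1 ≠ 0 := by
      rcases torB_zero_ne_zero_adj hK hNf hT (isBlockUnion_fine hT') (c := Sum.inr q) (c' := Sum.inl y) h21 with he | ht
      · exact Or.inl (he.symm)
      · right; rwa [tadj_comm (label_mem hNf hT y) (label_mem hNf hT q.1)]
    rw [if_pos hxp, if_pos hyq, one_mul, one_mul, abs_mul, abs_mul]
    have hD : |(H.toBlocks₂₂)⁻¹ p q| ≤ Kq := by
      refine (torFluct_inv_entry_decay hn hK hNf hT hT' hθ hθs p q).trans ?_
      rw [hKq]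
      refine mul_le_mul_of_nonneg_left (Real.exp_le_exp.2 ?_) (by positivity)
      have h1 := supNorm_near hK hNf hT hxp
      have h2 := supNorm_near hK hNf hT hyq
      rw [abs_le] at h1 h2
      nlinarith [h1.1, h1.2, h2.1, h2.2, hθ]
    have h1 : |H.toBlocks₁₂ x p| ≤ θD := abs_torB_inr_le hNf' hT _ (Sum.inl x) p
    have h2 : |H.toBlocks₂₁ q y| ≤ θD := abs_torB_inr_le' hNf' hT _ q (Sum.inl y)
    calc |H.toBlocks₁₂ x p| * |(H.toBlocks₂₂)⁻¹ p q| * |H.toBlocks₂₁ q y| ≤ θD * Kq * θD :=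
          mul_le_mul (mul_le_mul h1 hD (abs_nonneg _) hθD0) h2 (abs_nonneg _) (mul_nonneg hθD0 hKq0)
      _ = θD * Kq * θD := rfl
  refine (Finset.abs_sum_le_sum_abs _ _).trans ?_
  refine (Finset.sum_le_sum fun q _ => (Finset.abs_sum_le_sum_abs _ _).trans (Finset.sum_le_sum fun p _ => hterm q p)).trans ?_
  have hcount₁ := card_filter_near_le hK hNf hT x
  have hcount₂ := card_filter_near_le hK hNf hT y
  have hsum : ∑ q : ↥(T.image (blk L)) × NZ d L, ∑ p : ↥(T.image (blk L)) × NZ d L,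
      (if (x = p.1 ∨ tadj K x.1 p.1.1 ≠ 0) then (1 : ℝ) else 0) * (if (y = q.1 ∨ tadj K y.1 q.1.1 ≠ 0) then (1 : ℝ) else 0) *
        (θD * Kq * θD) =
      ((univ.filter fun p : ↥(T.image (blk L)) × NZ d L => x = p.1 ∨ tadj K x.1 p.1.1 ≠ 0).card : ℝ) *
        ((univ.filter fun q : ↥(T.image (blk L)) × NZ d L => y = q.1 ∨ tadj K y.1 q.1.1 ≠ 0).card : ℝ) * (θD * Kq * θD) := by
    have e1 : ∀ q : ↥(T.image (blk L)) × NZ d L, ∑ p : ↥(T.image (blk L)) × NZ d L,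
        (if (x = p.1 ∨ tadj K x.1 p.1.1 ≠ 0) then (1 : ℝ) else 0) * (if (y = q.1 ∨ tadj K y.1 q.1.1 ≠ 0) then (1 : ℝ) else 0) *
          (θD * Kq * θD) =
        ((univ.filter fun p : ↥(T.image (blk L)) × NZ d L => x = p.1 ∨ tadj K x.1 p.1.1 ≠ 0).card : ℝ) *
          ((if (y = q.1 ∨ tadj K y.1 q.1.1 ≠ 0) then (1 : ℝ) else 0) * (θD * Kq * θD)) := by
      intro q
      rw [← Finset.sum_mul, ← Finset.sum_mul, mul_assoc]
      congr 1
      rw [Finset.sum_boole]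
    simp_rw [e1]
    rw [← Finset.mul_sum, ← Finset.sum_mul, Finset.sum_boole]
    ring
  rw [hsum]
  have hK0 : 0 ≤ θD * Kq * θD := by positivity
  calc ((univ.filter fun p : ↥(T.image (blk L)) × NZ d L => x = p.1 ∨ tadj K x.1 p.1.1 ≠ 0).card : ℝ) *
        ((univ.filter fun q : ↥(T.image (blk L)) × NZ d L => y = q.1 ∨ tadj K y.1 q.1.1 ≠ 0).card : ℝ) * (θD * Kq * θD)
      ≤ ((2 * (d : ℝ) + 3) * (L : ℝ) ^ (d + 1)) * ((2 * (d : ℝ) + 3) * (L : ℝ) ^ (d + 1)) * (θD * Kq * θD) :=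
        mul_le_mul_of_nonneg_right (mul_le_mul hcount₁ hcount₂ (Nat.cast_nonneg _) (by positivity)) hK0
    _ = (n : ℝ) ^ 2 * (64 * ((d : ℝ) + 1) ^ 2 * (2 * (d : ℝ) + 3) ^ 2 * (L : ℝ) ^ (d + 5)) *
        Real.exp (-(θ * (ρx - ρy - 2))) := by
        rw [hθD, hKq]
        field_simp
        ring

/-- the coarse block `(H_B^𝕋)₁₁` has torus range one. [folklore] -/
theorem torB₁₁_eq_zero_of_far (hK : ∀ i, 1 ≤ K i) (hNf : Nf = fun i => L * K i) (hT : T = boxDom (dbl Nf))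
    (hT' : IsBlockUnion (n * L) T) (x y : ↥(T.image (blk L))) (hfar : ¬ (x = y ∨ tadj K x.1 y.1 ≠ 0)) :
    (torB (isBlockUnion_fine hT') n 0 Nf).toBlocks₁₁ x y = 0 := by
  by_contra h
  exact hfar (torB_zero_ne_zero_adj hK hNf hT (isBlockUnion_fine hT') (c := Sum.inl x) (c' := Sum.inl y) h)

omit [NeZero L] in
/-- the coarse periodic operator has torus range one. [folklore] -/
theorem torOpK_eq_zero_of_far (x y : ↥(T.image (blk L))) (hfar : ¬ (x = y ∨ tadj K x.1 y.1 ≠ 0)) :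
    torOpK n 0 K (T.image (blk L)) x y = 0 := by
  rw [not_or, not_not] at hfar
  rw [torOpK_apply, if_neg hfar.1, hfar.2]
  simp

/-- **I3 ON THE TORUS, CENTRED FORM**: for `θ ≥ 0` with `16(d+1)²L^{d+3}(e^θ − 1) ≤ 1`, every `s ∈ [0,1]` and EVERY label `x`,
`|T^𝕋(s)(x, c₀)| ≤ 2n²·64(d+1)²(2d+3)²L^{d+5}·e^{−θ(|x − c₀|_∞ − 2)}` (`c₀` the centre label; far from `c₀` only the Schur correction
survives, near `c₀` the local parts are `≤ n²(2(d+1) + 4(d+1)L²)` and the exponential is `≥ 1`). [folklore] -/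
theorem torLine_entry_decay_ctr (hn : 1 ≤ n) (hK : ∀ i, 1 ≤ K i) (hNf : Nf = fun i => L * K i) (hT : T = boxDom (dbl Nf))
    (hT' : IsBlockUnion (n * L) T) {θ : ℝ} (hθ : 0 ≤ θ)
    (hθs : 16 * ((d : ℝ) + 1) ^ 2 * (L : ℝ) ^ (d + 3) * (Real.exp θ - 1) ≤ 1) {s : ℝ} (hs0 : 0 ≤ s) (hs1 : s ≤ 1)
    (x : ↥(T.image (blk L))) (c₀ : ↥(T.image (blk L))) (hc₀ : c₀.1 = fun i => (K i : ℤ)) :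
    |torLine (isBlockUnion_fine hT') n 0 Nf K s x c₀| ≤
      2 * ((n : ℝ) ^ 2 * (64 * ((d : ℝ) + 1) ^ 2 * (2 * (d : ℝ) + 3) ^ 2 * (L : ℝ) ^ (d + 5))) *
        Real.exp (-(θ * (supNorm (x.1 - fun i => (K i : ℤ)) - 2))) := by
  have hNf' : ∀ i, 1 ≤ Nf i := by subst hNf; exact mul_pos_side (NeZero.one_le : 1 ≤ L) hK
  have hL1 : (1 : ℝ) ≤ L := by exact_mod_cast (NeZero.one_le : 1 ≤ L)
  have hTc := labels_eq hNf hT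
  set H := torB (isBlockUnion_fine hT') n 0 Nf with hH
  set C : ℝ := (n : ℝ) ^ 2 * (64 * ((d : ℝ) + 1) ^ 2 * (2 * (d : ℝ) + 3) ^ 2 * (L : ℝ) ^ (d + 5)) with hC
  set ρ := supNorm (x.1 - fun i => (K i : ℤ)) with hρ
  have hcorr := torSchur_correction_entry_decay hn hK hNf hT hT' hθ hθs x c₀
  rw [hc₀, sub_self, B4BoxCov237.supNorm_zero', sub_zero] at hcorr
  have hE1 : 1 ≤ Real.exp (-(θ * (ρ - 2))) ∨ ¬ (x = c₀ ∨ tadj K x.1 c₀.1 ≠ 0) := by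
    by_cases hnear : x = c₀ ∨ tadj K x.1 c₀.1 ≠ 0
    · left
      have hρ1 : ρ ≤ 1 := by
        rcases hnear with rfl | h
        · rw [hρ, hc₀, sub_self, B4BoxCov237.supNorm_zero']; norm_num
        · have h' : tadj K c₀.1 x.1 ≠ 0 := by rwa [tadj_comm (label_mem hNf hT c₀) (label_mem hNf hT x)]
          rw [hc₀] at h'
          exact supNorm_sub_ctr_le_one_of_adj_ctr hK h'
      have : 0 ≤ -(θ * (ρ - 2)) := by nlinarith
      exact Real.one_le_exp_iff.2 this |> fun h => h
    · right; exact hnear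
  -- the entry of the line
  have hentry : torLine (isBlockUnion_fine hT') n 0 Nf K s x c₀ =
      (1 - s) * torOpK n 0 K (T.image (blk L)) x c₀ + s * (H.toBlocks₁₁ x c₀ -
        (H.toBlocks₁₂ * (H.toBlocks₂₂)⁻¹ * H.toBlocks₂₁) x c₀) := by
    unfold torLine
    rw [lineOpR_eq_schurC, Matrix.add_apply, Matrix.smul_apply, Matrix.smul_apply, schurC, Matrix.sub_apply, smul_eq_mul,
      smul_eq_mul]
  have hC0 : 0 ≤ C := by rw [hC]; positivity
  have hP : |torOpK n 0 K (T.image (blk L)) x c₀| ≤ (n : ℝ) ^ 2 * (2 * ((d : ℝ) + 1)) := by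
    rw [torOpK_apply]
    simp only [zero_mul, ite_self, add_zero, abs_mul, abs_pow, Nat.abs_cast]
    refine mul_le_mul_of_nonneg_left ?_ (by positivity)
    have ht : (tadj K x.1 c₀.1 : ℝ) ≤ 2 * ((d : ℝ) + 1) := by
      have := Finset.single_le_sum (fun y _ => Nat.zero_le (tadj K x.1 y)) (hTc ▸ c₀.2 : c₀.1 ∈ boxDom (dbl K))
      rw [sum_tadj hK x.1] at this
      exact_mod_cast this
    have ht0 : (0 : ℝ) ≤ (tadj K x.1 c₀.1 : ℝ) := by positivity
    split_ifs <;> rw [abs_le] <;> constructor <;> linarith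
  have hH11 : |H.toBlocks₁₁ x c₀| ≤ 4 * ((d : ℝ) + 1) * (n : ℝ) ^ 2 * (L : ℝ) ^ 2 := abs_torB_inl_inl_le hNf' hT _ x c₀
  -- the local parts are `≤ C` (crudely)
  have hloc : (n : ℝ) ^ 2 * (2 * ((d : ℝ) + 1)) + 4 * ((d : ℝ) + 1) * (n : ℝ) ^ 2 * (L : ℝ) ^ 2 ≤ C := by
    have hd : (0 : ℝ) ≤ d := Nat.cast_nonneg d
    have hL2 : (1 : ℝ) ≤ (L : ℝ) ^ 2 := one_le_pow₀ hL1
    have h2 : (L : ℝ) ^ 2 ≤ (L : ℝ) ^ (d + 5) := pow_le_pow_right₀ hL1 (by omega)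
    have h3 : (9 : ℝ) ≤ (2 * (d : ℝ) + 3) ^ 2 := by nlinarith [hd]
    have hd1 : (1 : ℝ) ≤ (d : ℝ) + 1 := by linarith
    have hbig : 2 + 4 * (L : ℝ) ^ 2 ≤ 64 * ((d : ℝ) + 1) * (2 * (d : ℝ) + 3) ^ 2 * (L : ℝ) ^ (d + 5) := by
      have hA : 2 + 4 * (L : ℝ) ^ 2 ≤ 64 * 1 * 9 * (L : ℝ) ^ 2 := by linarith
      have hB : 64 * 1 * 9 * (L : ℝ) ^ 2 ≤ 64 * ((d : ℝ) + 1) * (2 * (d : ℝ) + 3) ^ 2 * (L : ℝ) ^ (d + 5) :=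
        mul_le_mul (mul_le_mul (mul_le_mul_of_nonneg_left hd1 (by norm_num)) h3 (by norm_num) (by positivity)) h2
          (by positivity) (by positivity)
      linarith
    have e : C = (n : ℝ) ^ 2 * ((d : ℝ) + 1) * (64 * ((d : ℝ) + 1) * (2 * (d : ℝ) + 3) ^ 2 * (L : ℝ) ^ (d + 5)) := by
      rw [hC]; ring
    rw [e, show (n : ℝ) ^ 2 * (2 * ((d : ℝ) + 1)) + 4 * ((d : ℝ) + 1) * (n : ℝ) ^ 2 * (L : ℝ) ^ 2 =
      (n : ℝ) ^ 2 * ((d : ℝ) + 1) * (2 + 4 * (L : ℝ) ^ 2) by ring]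
    exact mul_le_mul_of_nonneg_left hbig (by positivity)
  rw [hentry]
  rcases hE1 with hexp | hfar
  · -- near: bound everything by `C·e` termwise
    set E := C * Real.exp (-(θ * (ρ - 2))) with hE
    have hCE : C ≤ E := le_mul_of_one_le_right hC0 hexp
    have hE0 : 0 ≤ E := hC0.trans hCE
    have hcorr' : |(H.toBlocks₁₂ * (H.toBlocks₂₂)⁻¹ * H.toBlocks₂₁) x c₀| ≤ E := hcorr
    have e1 : |torOpK n 0 K (T.image (blk L)) x c₀| ≤ E := by
      refine hP.trans (le_trans ?_ (hloc.trans hCE))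
      have : 0 ≤ 4 * ((d : ℝ) + 1) * (n : ℝ) ^ 2 * (L : ℝ) ^ 2 := by positivity
      linarith
    have e2 : |H.toBlocks₁₁ x c₀| ≤ E := by
      refine hH11.trans (le_trans ?_ (hloc.trans hCE))
      have : 0 ≤ (n : ℝ) ^ 2 * (2 * ((d : ℝ) + 1)) := by positivity
      linarith
    have hs1' : 0 ≤ 1 - s := by linarith
    calc |(1 - s) * torOpK n 0 K (T.image (blk L)) x c₀ + s * (H.toBlocks₁₁ x c₀ - (H.toBlocks₁₂ * (H.toBlocks₂₂)⁻¹ * H.toBlocks₂₁) x c₀)|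
        ≤ (1 - s) * |torOpK n 0 K (T.image (blk L)) x c₀| +
            s * (|H.toBlocks₁₁ x c₀| + |(H.toBlocks₁₂ * (H.toBlocks₂₂)⁻¹ * H.toBlocks₂₁) x c₀|) := by
          refine (abs_add_le _ _).trans ?_
          rw [abs_mul, abs_mul, abs_of_nonneg hs1', abs_of_nonneg hs0]
          exact add_le_add le_rfl (mul_le_mul_of_nonneg_left (abs_sub _ _) hs0)
      _ ≤ (1 - s) * E + s * (E + E) :=
          add_le_add (mul_le_mul_of_nonneg_left e1 hs1') (mul_le_mul_of_nonneg_left (add_le_add e2 hcorr') hs0)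
      _ = (1 + s) * E := by ring
      _ ≤ 2 * E := mul_le_mul_of_nonneg_right (by linarith) hE0
      _ = 2 * C * Real.exp (-(θ * (ρ - 2))) := by rw [hE]; ring
  · -- far: only the Schur correction survives
    have hE0 : 0 ≤ C * Real.exp (-(θ * (ρ - 2))) := mul_nonneg hC0 (Real.exp_nonneg _)
    rw [torOpK_eq_zero_of_far x c₀ hfar, torB₁₁_eq_zero_of_far hK hNf hT hT' x c₀ hfar, mul_zero, zero_add,
      zero_sub, mul_neg, abs_neg, abs_mul, abs_of_nonneg hs0]
    calc s * |(H.toBlocks₁₂ * (H.toBlocks₂₂)⁻¹ * H.toBlocks₂₁) x c₀| ≤ 1 * (C * Real.exp (-(θ * (ρ - 2)))) :=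
          mul_le_mul hs1 hcorr (abs_nonneg _) zero_le_one
      _ ≤ 2 * C * Real.exp (-(θ * (ρ - 2))) := by linarith

end Line

/-! ### §2 Translation: I3 on the doubled torus for every pair of labels -/

section Transl

variable {M : Fin (d + 1) → ℕ}

/-- **I3 ON THE TORUS**: at `a = 0`, for `θ ≥ 0` with `16(d+1)²L^{d+3}(e^θ − 1) ≤ 1`, every `s ∈ [0,1]`, every mesh `n ≥ 1`, every
torus `M` and all labels `x, y` of the doubled torus `boxDom (dbl (n·M))`:
`|T^𝕋(s)(x, y)| ≤ 2n²·64(d+1)²(2d+3)²L^{d+5}·e^{−θ(|(x + (c₀ − y)) mod 2nM − c₀|_∞ − 2)}`, `c₀ = (nM_μ)` — the exponent is the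
TORUS sup-distance of `x` and `y`; rate and prefactor∕n² FREE of the mesh and of the torus size. [folklore] -/
theorem torLine_entry_decay (hn : 1 ≤ n) (hM : ∀ i, 1 ≤ M i) {θ : ℝ} (hθ : 0 ≤ θ)
    (hθs : 16 * ((d : ℝ) + 1) ^ 2 * (L : ℝ) ^ (d + 3) * (Real.exp θ - 1) ≤ 1) {s : ℝ} (hs0 : 0 ≤ s) (hs1 : s ≤ 1)
    (x y : ↥((boxDom (dbl fun i => n * L * M i)).image (blk L))) :
    |torLine (isBlockUnion_fine (fineTor_isBlockUnion hn (NeZero.one_le : 1 ≤ L) M)) n 0 (fun i => n * L * M i)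
        (fun i => n * M i) s x y| ≤
      2 * ((n : ℝ) ^ 2 * (64 * ((d : ℝ) + 1) ^ 2 * (2 * (d : ℝ) + 3) ^ 2 * (L : ℝ) ^ (d + 5))) *
        Real.exp (-(θ * (supNorm (wrap (dbl fun i => n * M i) (x.1 + ((fun i => ((n * M i : ℕ) : ℤ)) - y.1)) -
          fun i => ((n * M i : ℕ) : ℤ)) - 2))) := by
  have hL : 1 ≤ L := NeZero.one_le
  have hK : ∀ i, 1 ≤ (fun i => n * M i) i := mul_pos_side hn hM
  -- translate by `v = c₀ − y`: `T(x, y) = T(x + v, c₀)`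
  set v : Fin (d + 1) → ℤ := (fun i => ((n * M i : ℕ) : ℤ)) - y.1 with hv
  have htr := torLine_zero_transl_apply hn hM v s x y (L := L)
  have hy : wrap (dbl fun i => n * M i) (y.1 + v) = fun i => ((n * M i : ℕ) : ℤ) := by
    rw [hv, add_sub_cancel, wrap_eq_self (ctr_mem hK)]
  rw [← htr]
  have hc₀ : (⟨wrap (dbl fun i => n * M i) (y.1 + v), wrap_add_mem_image hn hM y.1 v⟩ :
      ↥((boxDom (dbl fun i => n * L * M i)).image (blk L))).1 = fun i => (((fun i => n * M i) i : ℕ) : ℤ) := hy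
  have h := torLine_entry_decay_ctr (K := fun i => n * M i) (Nf := fun i => n * L * M i) hn hK (side_eq n L M) rfl
    (fineTor_isBlockUnion hn hL M) hθ hθs hs0 hs1 ⟨wrap (dbl fun i => n * M i) (x.1 + v), wrap_add_mem_image hn hM x.1 v⟩
    ⟨wrap (dbl fun i => n * M i) (y.1 + v), wrap_add_mem_image hn hM y.1 v⟩ hc₀
  exact h

end Transl

end Summit.QuantumFields.BalabanUV.T4Continuum.NE7K1LinTorusKernelDecay

end
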